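import Summits.BirchSwinnertonDyer.BirchSwinnertonDyer.Theorems.ByReductionTypeAtTwoOrdKatoHalfAtTwoIsoKatoIntSignFreeDoor
import Summits.BirchSwinnertonDyer.BirchSwinnertonDyer.Theorems.ByReductionTypeAtTwoOrdKatoHalfAtTwoIsoOptimalOff514Defs
import HarnessLib

/-!
# Route ByReductionTypeAtTwo, crux `OrdKatoHalfAtTwoIso` (stmt-BirchSwinnertonDyer-19573), line
# `steinberg-fibre-at-two`: the SIGN-FREE RE-CUT of the binder set (lead g5) — Kato's zeta classes in Coleman
# coordinates at `2` WITHOUT the sign of `Δ`, and the core Theorem A at `2` on `0 < Δ` (the real place), displayed by name,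
# with the KERNEL doors «two sign-free binders + print + B7′ ⇒ the crux», B8 derived, not assumed

Seat `cruxlead-stmt-BirchSwinnertonDyer-19573-g5` (LEAD PROVER, MODE LINE; HOME `run/shared/lean/pub/bsd-2adic/`;
`--supports` the crux stmt-BirchSwinnertonDyer-19573; pen RC-366 «P7-CANDIDATE: sign-free re-cut — the lead's call»).
HONEST FRAMING (cell bsd-2adic): BSD is not proved by any of this; the crux `OrdKatoHalfAtTwoIso` is NOT proved here; the two
definitions below are OPEN statements DISPLAYED BY NAME (memo-tier readings at `p = 2`), nothing is asserted about them,
and every theorem that mentions the crux, B8, the residue binder or `μ = 0` is CONDITIONAL on the displayed binders it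
names. Pattern of the line's earlier binder files (p655368 `…SteinbergDefs`, p678187 `…ZetaColemanMuDefs`, p679274
`…OptimalOff514Defs`: definitions + the kernel composition in one module).

WHY THIS FILE. The width seat w2 (p681344, p681540, p682357, p682426, p682874) showed that the sign `Δ_W < 0` enters the
whole line at EXACTLY ONE call — the real place in Step 4 of Ω2 = (H-K) (`StepFour.convCoeff_eq_zero_of_qTermIdentity_modPTwist_two
… hΔ`; `hinf : H¹(ℝ, 𝒯_J(E)) = 0` ⟺ `Δ < 0`) — and landed the door «{zeta classes in Coleman coordinates at `2`, sign-free}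
+ {core Theorem A at `2`, sign-free} + Abbes–Ullmo + B7 + Kato 17.4 (1)(2) ⇒ the crux BY NAME, and ⇒ B8»
(`ordKatoHalfAtTwoIso_of_zetaColemanMu_signFree_of_core_signFree`, hypotheses INLINE). The lead's decision (RC-366) is to
NAME the two sign-free binders and re-cut the skeleton / the route's children to them (P7), so that B8 = child 23762
`KatoIntAtGoodOrdSurjectiveTwo` (Kato 17.4 (3) transported to `p = 2` — a CONCLUSION-level binder) is no longer assumed but
DERIVED, and the crux's beyond-print content on the `ρ̄₂`-onto stratum is displayed as exactly two readings:

* `ZetaColemanMuInputsAtTwo` — **F1μ⁺ (§1)**: the body of the registered F1μ = child 23890 `ZetaColemanMuInputsNegDiscAtTwo`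
  (p678187) with the binder `W.Δ < 0 →` DELETED. Kato §§12–17 at `2` do not see the sign: (L) the local Coleman dual pair at
  `2` and (E) the zeta image clause at `(2)` are local at `2`; (R) the reciprocity `⟨loc₂ z, loc₂ s⟩₂ = 0` has NO archimedean
  term for EITHER sign because the tree's `Sel_{2^∞}(E/ℚ_∞)` (`selmerGroupOver`) is STRICT at the infinite places
  (`s_w = 0`), cf. w3's p682177 (Selmer side of F1μ is kernel; beyond-print = (L)+(R)+(E)).
* `CoreTheoremAPosDiscTwo` — **CoreA⁺ on `0 < Δ` (§1)**: the body of the registered socket 1 `CoreTheoremATwoResidue`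
  (p655368) with `W.Δ < 0` REPLACED by `0 < W.Δ`. Its `Δ < 0` twin is a THEOREM (`coreTheoremATwoResidue_holds`, p669276),
  so (§2, `core_signFree_of_coreTheoremAPosDiscTwo`, trichotomy via `W.isUnit_Δ`) the `0 < Δ` binder ALONE gives w2's
  sign-free core. Filed at the CoreA level, not the H-K level: T1 (p663770), the sign-free H-C (p681540) and the count are
  theorems, so its beyond-kernel content is exactly **H-K at the REAL place** (w2's H-K⁺ sketch: at `0 < Δ` both
  `loc_∞` of the Kolyvagin class — a reduction of a `T₂E`-class, `H¹(ℝ, T₂E) = E(ℝ) ⊗ ℤ₂` — and `loc_∞` of the strict-at-`∞`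
  Selmer-side class lie in the Kummer LINE `(c − 1)·E[4] ⊂ E[2]` slotwise, isotropic for the Weil pairing, so the
  archimedean local term of Poitou–Tate vanishes without `hinf`; real-quadratic Kolyvagin fields `q ≡ 1 (4)` via Rubin's
  `τ` p682874, where `ρ_{W,2^∞}` onto — automatic on `ρ̄₂` onto ∧ `0 < Δ` by Dokchitser–Dokchitser — is load-bearing),
  while its TEXT is stable under refinements of the H-K⁺ interface (T1⁺ exporting the real condition, H-C⁺ with `τ·i = i`).
  The verbatim «H-K minus `Δ < 0`» (w2's inline `hK`) is NOT filed: it quantifies over Selmer-side cocycles with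
  finite-place conditions only, so its real term is uncontrolled — the wrong sign-free statement (lead g5 / w2 concur).

THE KERNEL CHAIN (§§2–3): monotonicity to the registered constants (F1μ⁺ ⇒ F1μ; CoreA⁺ ⇒ sign-free core ⇒
`CoreTheoremATwoResidue`); B8 `KatoIntAtGoodOrdSurjectiveTwo` BY NAME from F1μ⁺ + CoreA⁺ + Abbes–Ullmo + 17.4 (1)(2)
(`katoIntAtGoodOrdSurjectiveTwo_of_signFree`); the crux BY NAME from F1μ⁺ + CoreA⁺ + Abbes–Ullmo + B7 + 17.4 (1)(2)
(`ordKatoHalfAtTwoIso_of_signFree`), from … + Prop. 5.14@2 + the re-cut B7′ (`…_of_signFree_recut`), and in the shape the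
split glue consumes after the P7 restates — bundle `PUB ∧ AU ∧ 5.14`, F1 slot := F1μ⁺, B7 slot := B7′ or B7, B8 slot :=
CoreA⁺ (`…_of_signFree_cite`, `…_of_signFree_cite_B7`). Axioms of every door: propext, Classical.choice, Quot.sound.
HABITAT BOOKKEEPING: non-CM ∧ good-ordinary at `2` = [`ρ̄₂` not onto → B7/B7′ (+ 5.14 print)] ⊔ [`ρ̄₂` onto → lower
divisibility AT `W` from F1μ⁺ + sign-free core]; inside `ρ̄₂` onto, `Δ < 0` ⊇ the DD12 residue (core PROVED), `0 < Δ` ⊆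
`ρ_{2^∞}` onto (core = the binder). Nothing else changes; B7′'s content (MEMO-7 off the 5.14 locus) is untouched.

References: [Kato2004Asterisque] Thm 12.6, (14.9.3), 16.6, 17.4, 17.11, §17.13; [MazurRubin2004] Prop 1.3.2, §3, §5.3;
[Rubin2000] §4.4–4.5; [GreenbergLNM1716] Conj 1.11, Prop 5.14, p. 170; [AbbesUllmo1996] Thm A; [MilneADT2006] I Thm 4.10;
[DokchitserDokchitserMathZ2012]; MEMO-5′/MEMO-6/MEMO-7 (HOME); w2's `B8-RECUT-SIGNFREE-w2.md` (evidence on 23762); the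
line's files p655368, p658966, p663770, p669276, p678187, p678698, p679274, p680193, p681540, p682177, p682357, p682426, p682874.
-/

set_option autoImplicit false
set_option linter.dupNamespace false

noncomputable section

open scoped Classical MatrixGroups ModularForm NumberField
open CongruenceSubgroup WeierstrassCurve Field IsDedekindDomain NumberField
open Literature.NumberTheory.GaloisRepresentations
open Literature.NumberTheory.GaloisCohomology
open Literature.NumberTheory.EllipticCurves Literature.NumberTheory.EllipticCurves.ModularForms
open Literature.NumberTheory.EllipticCurves.Kato2004
  Literature.NumberTheory.EllipticCurves.Kato2004.EulerSystemValues
open Literature.NumberTheory.EllipticCurves.Rank1Residual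
open Literature.NumberTheory.EllipticCurves.Greenberg1999
open Summit.BirchSwinnertonDyer.Rank1Residual Summit.BirchSwinnertonDyer.Rank1Residual.X5
open Summit.BirchSwinnertonDyer.BirchSwinnertonDyer.Theorems.OrdKatoOptimalAtTwo
  Summit.BirchSwinnertonDyer.BirchSwinnertonDyer.Theorems.OrdKatoIntAtTwo
open Summit.BirchSwinnertonDyer.BirchSwinnertonDyer.Theses.ByReductionTypeAtTwo

namespace Summit.BirchSwinnertonDyer.BirchSwinnertonDyer.Theorems.SteinbergFibreAtTwo

/-! ## §1 The two sign-free binders, displayed by name -/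

/-- [MEMO tier, OPEN] **F1μ⁺ — Kato's zeta classes in Coleman coordinates at `p = 2`, SIGN-FREE (lead g5).** For every
globally minimal `W`, good ordinary at `2`, with `ρ̄_{W,2}` onto `GL₂(𝔽₂)` — NO sign of `Δ_W`, no `2`-adic image
hypothesis, no `¬CM` — its newform `f`, the cyclotomic `(κ, γ)`: every Selmer dual datum `D` and fine Selmer dual datum
`Y` carry the per-datum `μ`-inputs `HasZetaColemanMuInputsAtTwo W f κ γ hκ D Y` (p678187: pinned `𝐇¹`, `Z` inside the
span of GENUINE `2`-adic Euler-system classes, an ideal `P ⊆ Λ`, `ℓ : 𝐇¹ → P`, `τ : P → X` killing `ℓ(Z)` with image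
`ker(X ↠ X₀)`, and the zeta image clause at `(2)`). VERBATIM the body of the registered F1μ `ZetaColemanMuInputsNegDiscAtTwo`
(= K4 child 23890) with `W.Δ < 0 →` deleted; = the inline hypothesis `hZ` of w2's p682426. The sign is invisible to Kato
§§12–17 at `2` ((L)/(E) local at `2`; (R) has no archimedean term since `Sel_{2^∞}(E/ℚ_∞)` is strict at `∞`). A READING of
Kato at `2`, NOT in print as stated; NOT a Literature fact; nothing asserted.
[cite: Kato2004Asterisque, Thm. 12.6 (p. 222), (14.9.3) (p. 240), Thm. 16.6 (p. 271), Prop. 17.11 (p. 277), §17.13 (pp. 279–280) (shape only; nothing asserted)] -/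
@[conjecture] def ZetaColemanMuInputsAtTwo : Prop :=
  ∀ (W : WeierstrassCurve ℚ) [W.IsElliptic] [W.IsGloballyMinimal]
    [ContinuousSMul ℤ_[2] (W.tateModule 2)] [Module.Free ℤ_[2] (W.tateModule 2)]
    [Module.Finite ℤ_[2] (W.tateModule 2)] {N : ℕ} [NeZero N] (f : CuspForm (Gamma0 N) 2)
    (κ : ZpExtension ℚ 2) (γ : absoluteGaloisGroup ℚ) (hκ : κ.IsCyclotomic),
    IsOrdinaryAt W 2 → W.HasSurjectiveModNGaloisRep 2 →
    κ.IsTopGenerator γ → IsCyclotomicVariable 2 γ → IsNewformOf W f →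
    ∀ (D : W.SelmerDualData κ γ) (Y : W.FineSelmerDualData κ γ),
      HasZetaColemanMuInputsAtTwo W f κ γ hκ D Y

/-- `ZetaColemanMuInputsAtTwo` unfolds to its displayed body. [folklore] -/
theorem zetaColemanMuInputsAtTwo_iff : ZetaColemanMuInputsAtTwo ↔
    ∀ (W : WeierstrassCurve ℚ) [W.IsElliptic] [W.IsGloballyMinimal]
      [ContinuousSMul ℤ_[2] (W.tateModule 2)] [Module.Free ℤ_[2] (W.tateModule 2)]
      [Module.Finite ℤ_[2] (W.tateModule 2)] {N : ℕ} [NeZero N] (f : CuspForm (Gamma0 N) 2)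
      (κ : ZpExtension ℚ 2) (γ : absoluteGaloisGroup ℚ) (hκ : κ.IsCyclotomic),
      IsOrdinaryAt W 2 → W.HasSurjectiveModNGaloisRep 2 →
      κ.IsTopGenerator γ → IsCyclotomicVariable 2 γ → IsNewformOf W f →
      ∀ (D : W.SelmerDualData κ γ) (Y : W.FineSelmerDualData κ γ),
        HasZetaColemanMuInputsAtTwo W f κ γ hκ D Y :=
  Iff.rfl

/-- [MEMO tier, OPEN] **CoreA⁺ — the core Theorem A at `2` on `0 < Δ` (the REAL place; lead g5).** For every globally
minimal `W`, good ordinary at `2`, `ρ̄_{W,2}` onto, `0 < Δ_W` (three real `2`-torsion points: complex conjugation acts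
TRIVIALLY on `E[2]`, so `H¹(ℝ, 𝒯_J(E)) ≠ 0` and the line's Step 4 `hinf` is unavailable), the cyclotomic `(κ, γ)` and a
pinned `𝐇¹`: a genuine `2`-adic Euler-system class `∉ 2𝐇¹` kills the `E[2]`-lifts of `Sel₀(E/ℚ_∞)` by a power of `T`.
VERBATIM the body of the registered socket 1 `CoreTheoremATwoResidue` (p655368; PROVED on `Δ < 0`, p669276) with
`W.Δ < 0` replaced by `0 < W.Δ`. Closing it = (H-K) at the real place: Step 4's Poitou–Tate sum with the archimedean term
killed by the Kummer-line Lagrangian on both sides (strict-at-`∞` fine Selmer group; Kolyvagin classes reduced from `T₂E`),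
real-quadratic Kolyvagin fields `q ≡ 1 (4)` (Rubin's `τ`, p682874; `ρ_{W,2^∞}` onto is automatic here by
Dokchitser–Dokchitser) — MEMO-6's `c_∞ = 2` in kernel form; T1, H-C (sign-free) and the count are theorems. NOT in print at
`p = 2` (Mazur–Rubin / Rubin assume `p > 2` at the archimedean places); NOT a Literature fact; nothing asserted.
[cite: MazurRubin2004, Prop. 1.3.2 and §§3, 5.3 (shape only; nothing asserted)] [cite: Kato2004Asterisque, §13.8 (pp. 228–229) (shape only)] -/
@[conjecture] def CoreTheoremAPosDiscTwo : Prop :=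
  ∀ (W : WeierstrassCurve ℚ) [W.IsElliptic] [W.IsGloballyMinimal]
    [ContinuousSMul ℤ_[2] (W.tateModule 2)] [Module.Free ℤ_[2] (W.tateModule 2)]
    [Module.Finite ℤ_[2] (W.tateModule 2)]
    (κ : ZpExtension ℚ 2) (γ : absoluteGaloisGroup ℚ) (I : IwasawaH1Data W 2 κ γ)
    (hκ : κ.IsCyclotomic),
    W.HasGoodReductionAtPrime 2 → ¬ (2 : ℤ) ∣ W.frobeniusTrace 2 →
    W.HasSurjectiveModNGaloisRep 2 → 0 < W.Δ → κ.IsTopGenerator γ →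
    (∃ s : I.H, IsEulerSystemClassTwo W hκ I s ∧
      s ∉ IwasawaAlgebra.augIdealP 2 • (⊤ : Submodule (IwasawaAlgebra 2) I.H)) →
    ∃ J : ℕ, ∀ y : Literature.NumberTheory.EllipticCurves.subgroupH1 κ.kerSubgroup
        (WeierstrassCurve.geomTorsion W (2 : ℤ)),
      W.torsionToPrimaryH1Sub 2 κ.kerSubgroup y ∈ W.fineSelmerInfty κ →
        (⇑(Literature.NumberTheory.EllipticCurves.conjH1 κ.kerSubgroup
            (WeierstrassCurve.geomTorsion W (2 : ℤ)) γ -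
          AddMonoidHom.id (Literature.NumberTheory.EllipticCurves.subgroupH1 κ.kerSubgroup
            (WeierstrassCurve.geomTorsion W (2 : ℤ)))))^[J] y = 0

/-- `CoreTheoremAPosDiscTwo` unfolds to its displayed body. [folklore] -/
theorem coreTheoremAPosDiscTwo_iff : CoreTheoremAPosDiscTwo ↔
    ∀ (W : WeierstrassCurve ℚ) [W.IsElliptic] [W.IsGloballyMinimal]
      [ContinuousSMul ℤ_[2] (W.tateModule 2)] [Module.Free ℤ_[2] (W.tateModule 2)]
      [Module.Finite ℤ_[2] (W.tateModule 2)]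
      (κ : ZpExtension ℚ 2) (γ : absoluteGaloisGroup ℚ) (I : IwasawaH1Data W 2 κ γ)
      (hκ : κ.IsCyclotomic),
      W.HasGoodReductionAtPrime 2 → ¬ (2 : ℤ) ∣ W.frobeniusTrace 2 →
      W.HasSurjectiveModNGaloisRep 2 → 0 < W.Δ → κ.IsTopGenerator γ →
      (∃ s : I.H, IsEulerSystemClassTwo W hκ I s ∧
        s ∉ IwasawaAlgebra.augIdealP 2 • (⊤ : Submodule (IwasawaAlgebra 2) I.H)) →
      ∃ J : ℕ, ∀ y : Literature.NumberTheory.EllipticCurves.subgroupH1 κ.kerSubgroup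
          (WeierstrassCurve.geomTorsion W (2 : ℤ)),
        W.torsionToPrimaryH1Sub 2 κ.kerSubgroup y ∈ W.fineSelmerInfty κ →
          (⇑(Literature.NumberTheory.EllipticCurves.conjH1 κ.kerSubgroup
              (WeierstrassCurve.geomTorsion W (2 : ℤ)) γ -
            AddMonoidHom.id (Literature.NumberTheory.EllipticCurves.subgroupH1 κ.kerSubgroup
              (WeierstrassCurve.geomTorsion W (2 : ℤ)))))^[J] y = 0 :=
  Iff.rfl

/-! ## §2 KERNEL: the sign trichotomy and monotonicity to the registered constants -/

/-- **The sign-free core Theorem A at `2` from the `0 < Δ` binder ALONE (KERNEL)**: the `Δ < 0` half is the line's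
THEOREM `coreTheoremATwoResidue_holds` (p669276: T1 + H-C + H-K ∘ port), and `Δ ≠ 0` (`W.isUnit_Δ`). The conclusion is
verbatim the inline hypothesis `hcore` of w2's p682357/p682426. [cite: MazurRubin2004, Prop. 1.3.2 and §5.3] -/
theorem core_signFree_of_coreTheoremAPosDiscTwo (hpos : CoreTheoremAPosDiscTwo) :
    ∀ (W : WeierstrassCurve ℚ) [W.IsElliptic] [W.IsGloballyMinimal]
      [ContinuousSMul ℤ_[2] (W.tateModule 2)] [Module.Free ℤ_[2] (W.tateModule 2)]
      [Module.Finite ℤ_[2] (W.tateModule 2)]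
      (κ : ZpExtension ℚ 2) (γ : absoluteGaloisGroup ℚ) (I : IwasawaH1Data W 2 κ γ)
      (hκ : κ.IsCyclotomic),
      W.HasGoodReductionAtPrime 2 → ¬ (2 : ℤ) ∣ W.frobeniusTrace 2 →
      W.HasSurjectiveModNGaloisRep 2 → κ.IsTopGenerator γ →
      (∃ s : I.H, IsEulerSystemClassTwo W hκ I s ∧
        s ∉ IwasawaAlgebra.augIdealP 2 • (⊤ : Submodule (IwasawaAlgebra 2) I.H)) →
      ∃ J : ℕ, ∀ y : Literature.NumberTheory.EllipticCurves.subgroupH1 κ.kerSubgroup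
          (WeierstrassCurve.geomTorsion W (2 : ℤ)),
        W.torsionToPrimaryH1Sub 2 κ.kerSubgroup y ∈ W.fineSelmerInfty κ →
          (⇑(Literature.NumberTheory.EllipticCurves.conjH1 κ.kerSubgroup
              (WeierstrassCurve.geomTorsion W (2 : ℤ)) γ -
            AddMonoidHom.id (Literature.NumberTheory.EllipticCurves.subgroupH1 κ.kerSubgroup
              (WeierstrassCurve.geomTorsion W (2 : ℤ)))))^[J] y = 0 := by
  intro W _ _ _ _ _ κ γ I hκ hgood hord h2 hγ hs
  rcases lt_or_gt_of_ne W.isUnit_Δ.ne_zero with hΔ | hΔ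
  · exact coreTheoremATwoResidue_holds W κ γ I hκ hgood hord h2 hΔ hγ hs
  · exact hpos W κ γ I hκ hgood hord h2 hΔ hγ hs

/-- **Monotonicity: F1μ⁺ implies the registered F1μ `ZetaColemanMuInputsNegDiscAtTwo`** (= child 23890; drop `Δ < 0`).
[folklore] -/
theorem zetaColemanMuInputsNegDiscAtTwo_of_zetaColemanMuInputsAtTwo (hZ : ZetaColemanMuInputsAtTwo) :
    ZetaColemanMuInputsNegDiscAtTwo :=
  zetaColemanMuInputsNegDiscAtTwo_of_signFree hZ

/-- **Monotonicity: CoreA⁺ implies the registered socket 1 `CoreTheoremATwoResidue`** (indeed the latter is a theorem;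
recorded for the skeleton's bookkeeping). [folklore] -/
theorem coreTheoremATwoResidue_of_coreTheoremAPosDiscTwo (hpos : CoreTheoremAPosDiscTwo) : CoreTheoremATwoResidue :=
  coreTheoremATwoResidue_of_core_signFree (core_signFree_of_coreTheoremAPosDiscTwo hpos)

/-- **The converse bookkeeping: w2's inline sign-free core implies CoreA⁺** (restrict to `0 < Δ`). [folklore] -/
theorem coreTheoremAPosDiscTwo_of_core_signFree
    (hcore : ∀ (W : WeierstrassCurve ℚ) [W.IsElliptic] [W.IsGloballyMinimal]
      [ContinuousSMul ℤ_[2] (W.tateModule 2)] [Module.Free ℤ_[2] (W.tateModule 2)]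
      [Module.Finite ℤ_[2] (W.tateModule 2)]
      (κ : ZpExtension ℚ 2) (γ : absoluteGaloisGroup ℚ) (I : IwasawaH1Data W 2 κ γ)
      (hκ : κ.IsCyclotomic),
      W.HasGoodReductionAtPrime 2 → ¬ (2 : ℤ) ∣ W.frobeniusTrace 2 →
      W.HasSurjectiveModNGaloisRep 2 → κ.IsTopGenerator γ →
      (∃ s : I.H, IsEulerSystemClassTwo W hκ I s ∧
        s ∉ IwasawaAlgebra.augIdealP 2 • (⊤ : Submodule (IwasawaAlgebra 2) I.H)) →
      ∃ J : ℕ, ∀ y : Literature.NumberTheory.EllipticCurves.subgroupH1 κ.kerSubgroup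
          (WeierstrassCurve.geomTorsion W (2 : ℤ)),
        W.torsionToPrimaryH1Sub 2 κ.kerSubgroup y ∈ W.fineSelmerInfty κ →
          (⇑(Literature.NumberTheory.EllipticCurves.conjH1 κ.kerSubgroup
              (WeierstrassCurve.geomTorsion W (2 : ℤ)) γ -
            AddMonoidHom.id (Literature.NumberTheory.EllipticCurves.subgroupH1 κ.kerSubgroup
              (WeierstrassCurve.geomTorsion W (2 : ℤ)))))^[J] y = 0) :
    CoreTheoremAPosDiscTwo := by
  intro W _ _ _ _ _ κ γ I hκ hgood hord h2 _ hγ hs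
  exact hcore W κ γ I hκ hgood hord h2 hγ hs

/-! ## §3 KERNEL doors BY NAME: `μ = 0` on the sign-free habitat, B8 derived, the crux -/

/-- **`μ(X(E/ℚ_∞)) = 0` for every cyclotomic Selmer dual datum on the SIGN-FREE habitat «good ordinary at `2`, `ρ̄₂`
onto», modulo the two named binders** (w2's `mu_eq_zero_of_zetaColemanMu_signFree_of_core_signFree` with the binders by
name). [cite: Kato2004Asterisque, §17.13 (pp. 279–280)] [cite: GreenbergLNM1716, Conj. 1.11 (p. 64) (shape)] -/
theorem mu_eq_zero_of_signFree (hZ : ZetaColemanMuInputsAtTwo) (hpos : CoreTheoremAPosDiscTwo)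
    (W : WeierstrassCurve ℚ) [W.IsElliptic] [W.IsGloballyMinimal]
    (hgo : GoodOrd W 2) (h2 : W.HasSurjectiveModNGaloisRep 2)
    {N : ℕ} [NeZero N] (f : CuspForm (Gamma0 N) 2) (hf : IsNewformOf W f)
    (κ : ZpExtension ℚ 2) (γ : absoluteGaloisGroup ℚ) (hκ : κ.IsCyclotomic) (hγ : κ.IsTopGenerator γ)
    (hγ' : IsCyclotomicVariable 2 γ) (D : W.SelmerDualData κ γ) : D.mu = 0 :=
  mu_eq_zero_of_zetaColemanMu_signFree_of_core_signFree (core_signFree_of_coreTheoremAPosDiscTwo hpos) hZ W hgo h2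
    f hf κ γ hκ hγ hγ' D

/-- **B8 = child stmt-BirchSwinnertonDyer-23762 `KatoIntAtGoodOrdSurjectiveTwo` DERIVED, BY NAME, from F1μ⁺ + CoreA⁺**,
Abbes–Ullmo BY NAME and Kato 17.4 (1)(2) at `2` (`h17`) — w2's door with the binders named. CONDITIONAL; B8 is not proved.
[cite: Kato2004Asterisque, Thm. 17.4 (1)(2) (p. 273)] [cite: AbbesUllmo1996, Thm. A] -/
theorem katoIntAtGoodOrdSurjectiveTwo_of_signFree (hZ : ZetaColemanMuInputsAtTwo) (hpos : CoreTheoremAPosDiscTwo)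
    (hAU : abbesUllmo_not_dvd_maninConstant_of_not_dvd_level)
    (h17 : ∀ (V : WeierstrassCurve ℚ) [V.IsElliptic] [V.IsGloballyMinimal] [NeZero (V.conductorNorm ℤ)]
      (f : CuspForm (Gamma0 (V.conductorNorm ℤ)) 2), kato_divisibility_allPrimes V 2 (f := f)) :
    KatoIntAtGoodOrdSurjectiveTwo :=
  katoIntAtGoodOrdSurjectiveTwo_of_zetaColemanMu_signFree_of_core_signFree
    (core_signFree_of_coreTheoremAPosDiscTwo hpos) hZ hAU h17

/-- **The residue binder `OrdKatoHalfDD12ResidueTwo` from F1μ⁺ + CoreA⁺** (indeed from F1μ⁺ and the PROVED `Δ < 0` core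
alone, the residue being inside `Δ < 0`; stated with both binders for uniformity).
[cite: Kato2004Asterisque, Thm. 17.4 (1)(2) (p. 273)] [cite: AbbesUllmo1996, Thm. A] -/
theorem ordKatoHalfDD12ResidueTwo_of_signFree (hZ : ZetaColemanMuInputsAtTwo) (hpos : CoreTheoremAPosDiscTwo)
    (hAU : abbesUllmo_not_dvd_maninConstant_of_not_dvd_level)
    (h17 : ∀ (V : WeierstrassCurve ℚ) [V.IsElliptic] [V.IsGloballyMinimal] [NeZero (V.conductorNorm ℤ)]
      (f : CuspForm (Gamma0 (V.conductorNorm ℤ)) 2), kato_divisibility_allPrimes V 2 (f := f)) :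
    OrdKatoHalfDD12ResidueTwo :=
  ordKatoHalfDD12ResidueTwo_of_zetaColemanMu_signFree_of_core_signFree
    (core_signFree_of_coreTheoremAPosDiscTwo hpos) hZ hAU h17

/-- **The crux `OrdKatoHalfAtTwoIso` (stmt-BirchSwinnertonDyer-19573) BY NAME from the SIGN-FREE binder set**: F1μ⁺,
CoreA⁺ (memo, named), Abbes–Ullmo (print), the filed B7 `KatoMuPartAtOptimalMemberOfNotSurjectiveTwo` (memo) and Kato
17.4 (1)(2) at `2` (print) — B8 is NOT an input (it is derived, `katoIntAtGoodOrdSurjectiveTwo_of_signFree`). One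
application of w2's `ordKatoHalfAtTwoIso_of_zetaColemanMu_signFree_of_core_signFree`. Conditional; nothing closed.
[cite: Kato2004Asterisque, Thm. 17.4 (1)(2) (p. 273)] [cite: AbbesUllmo1996, Thm. A] -/
theorem ordKatoHalfAtTwoIso_of_signFree (hZ : ZetaColemanMuInputsAtTwo) (hpos : CoreTheoremAPosDiscTwo)
    (hAU : abbesUllmo_not_dvd_maninConstant_of_not_dvd_level)
    (hB7 : KatoMuPartAtOptimalMemberOfNotSurjectiveTwo)
    (h17 : ∀ (V : WeierstrassCurve ℚ) [V.IsElliptic] [V.IsGloballyMinimal] [NeZero (V.conductorNorm ℤ)]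
      (f : CuspForm (Gamma0 (V.conductorNorm ℤ)) 2), kato_divisibility_allPrimes V 2 (f := f)) :
    OrdKatoHalfAtTwoIso :=
  ordKatoHalfAtTwoIso_of_zetaColemanMu_signFree_of_core_signFree
    (core_signFree_of_coreTheoremAPosDiscTwo hpos) hZ hAU hB7 h17

/-- **The crux BY NAME from the FULLY RE-CUT sign-free binder set**: F1μ⁺, CoreA⁺, Abbes–Ullmo, Greenberg's Prop. 5.14
at `2` (print, by name), the re-cut B7′ `KatoMuPartOff514AtOptimalMemberOfNotSurjectiveTwo` (p679274), Kato 17.4 (1)(2)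
at `2`. Conditional; nothing closed.
[cite: Kato2004Asterisque, Thm. 17.4 (1)(2) (p. 273)] [cite: GreenbergLNM1716, Prop. 5.14] [cite: AbbesUllmo1996, Thm. A] -/
theorem ordKatoHalfAtTwoIso_of_signFree_recut (hZ : ZetaColemanMuInputsAtTwo) (hpos : CoreTheoremAPosDiscTwo)
    (hAU : abbesUllmo_not_dvd_maninConstant_of_not_dvd_level) (h514 : prop514_isTorsion_mu_eq_zero_two)
    (hB7' : KatoMuPartOff514AtOptimalMemberOfNotSurjectiveTwo)
    (h17 : ∀ (V : WeierstrassCurve ℚ) [V.IsElliptic] [V.IsGloballyMinimal] [NeZero (V.conductorNorm ℤ)]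
      (f : CuspForm (Gamma0 (V.conductorNorm ℤ)) 2), kato_divisibility_allPrimes V 2 (f := f)) :
    OrdKatoHalfAtTwoIso :=
  ordKatoHalfAtTwoIso_of_signFree hZ hpos hAU (katoMuPartAtOptimalMember_of_prop514_of_off514 h514 hB7') h17

/-- **The crux BY NAME in the shape the split glue `OrdKatoHalfAtTwoIsoOfChildren` consumes after the P7 restates**
(bundle = `PUB ∧ Abbes–Ullmo ∧ Prop. 5.14@2` = child 23889; F1 slot := F1μ⁺; B7 slot := the re-cut B7′; B8 slot :=
CoreA⁺): Kato 17.4 (1)(2) at `2` is the third conjunct of the PUB item. Conditional; nothing closed.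
[cite: Kato2004Asterisque, Thm. 17.4 (1)(2) (p. 273)] [cite: GreenbergLNM1716, Prop. 5.14] [cite: AbbesUllmo1996, Thm. A] -/
theorem ordKatoHalfAtTwoIso_of_signFree_cite (hZ : ZetaColemanMuInputsAtTwo) (hpos : CoreTheoremAPosDiscTwo)
    (hB : OrdPublishedInputsAtTwo ∧ abbesUllmo_not_dvd_maninConstant_of_not_dvd_level ∧
      prop514_isTorsion_mu_eq_zero_two)
    (hB7' : KatoMuPartOff514AtOptimalMemberOfNotSurjectiveTwo) : OrdKatoHalfAtTwoIso := by
  obtain ⟨hPub, hAU, h514⟩ := hB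
  obtain ⟨_, _, h17, _⟩ := hPub
  exact ordKatoHalfAtTwoIso_of_signFree_recut hZ hpos hAU h514 hB7' h17

/-- **The same glue shape with the FILED B7** `KatoMuPartAtOptimalMemberOfNotSurjectiveTwo` in the B7 slot (route state
before the B7′ restate; Prop. 5.14 then idle). Conditional; nothing closed.
[cite: Kato2004Asterisque, Thm. 17.4 (1)(2) (p. 273)] [cite: AbbesUllmo1996, Thm. A] -/
theorem ordKatoHalfAtTwoIso_of_signFree_cite_B7 (hZ : ZetaColemanMuInputsAtTwo) (hpos : CoreTheoremAPosDiscTwo)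
    (hB : OrdPublishedInputsAtTwo ∧ abbesUllmo_not_dvd_maninConstant_of_not_dvd_level ∧
      prop514_isTorsion_mu_eq_zero_two)
    (hB7 : KatoMuPartAtOptimalMemberOfNotSurjectiveTwo) : OrdKatoHalfAtTwoIso := by
  obtain ⟨hPub, hAU, -⟩ := hB
  obtain ⟨_, _, h17, _⟩ := hPub
  exact ordKatoHalfAtTwoIso_of_signFree hZ hpos hAU hB7 h17

end Summit.BirchSwinnertonDyer.BirchSwinnertonDyer.Theorems.SteinbergFibreAtTwo

end
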